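import Summits.BirchSwinnertonDyer.BirchSwinnertonDyer.Theorems.ByReductionTypeAtTwoMultUpperHalfGuarded
import Summits.BirchSwinnertonDyer.BirchSwinnertonDyer.Theorems.ByReductionTypeAtTwoTowerLayerGap
import Summits.BirchSwinnertonDyer.Rank1Residual.X5.TwoAdicTargetsTowerGapEnd
import Literature.NumberTheory.EllipticCurves.AnomalousOfRationalTorsionProofs
import HarnessLib

/-!
# Route `ByReductionTypeAtTwo`, crux `MultUpperHalfAtTwo` (item stmt-BirchSwinnertonDyer-19922): the TOWER road —
# the `μ = 0` input of road (i) CERTIFIED from two finite layers of the cyclotomic `ℤ₂`-tower, for EVERY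
# multiplicative-at-`2` class (no image hypothesis, no sign of `Δ`, no `2`-torsion geometry)

HONEST FRAMING (cell `bsd-2adic`, run/shared/lean/pub/bsd-2adic/, seat `bsd-2adic-mult-2` GEN 3, D-0074 row (A)):
research route; THEOREMS ONLY (no definition, no new named fact); nothing is booked; BSD is not proved by any of
this. PARTITION: X5@2 mult (K4ᵐ, RESIDUAL-MAP B1·O1; 1 976 book230 classes) × p = 2 — types-the-object-of (a
per-class door for the RESIDUAL of the line `four_roads`: 759 = 565 split ∧ surjective + 52 small `2`-adic image +
142 «neither» rank-`0` classes); closes none.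

WHY THIS FILE. The four landed roads to the upper half `ord₂ #Ш ≤ ord₂ #Ш_an` (`Typed.MissingUpperBoundAt W 2`)
at a multiplicative `2` (p418902 / p420150 / p424960 / p427239+p429114 / p430028) leave a residual whose ENTIRE
content at one member `W₁` of the class is the vanishing `μ(X(E₁/ℚ_∞)) = 0` (road (i): Kato `⊗ℚ` + `μ = 0` +
`0 ≤ ord₂ ϖ` ⟹ integral divisibility ⟹ control at `T = 0`). On the residual no Euler-system door certifies
`μ = 0`: the 565 split classes wait on Lemma S of HOME/mult/PROOF-KATO2MULT.md §5.3, the 52 small-image classes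
fail Rubin's `Hyp(ℚ_∞, T)` (ibid. §7 V3: `ℚ(√Δ) ⊂ ℚ(μ_{2^∞})`), the 142 «neither» optimal curves have reducible
`E[2]`. The ONE door in sight for all of them (ibid. §7 V6, «NOT RUN») is the TOWER-GAP certificate of the
good-ordinary lanes (`X5/TwoAdicTargetsTowerGap{,End}.lean`, cell b2b-bsdres; tower-1 p424818…p428637): ONE gap
`#X/(2,T^{m+k})X < 2^k · #X/(2,T^m)X` between two layers forces `X/2X` finite, hence `X` torsion AND `μ = 0`
(`O1.isTorsion_and_mu_eq_zero_of_towerGapAtTwo` — pure `Λ`-algebra: NO reduction hypothesis, NO image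
hypothesis), and the layer quotients are read off finite-layer Selmer groups plus LOCAL KERNEL bounds
(`KatoHalfPinch.towerGapAtTwo_of_localKernelBounds`, p428126 — reduction-type-free except through its displayed
local hypotheses). This file composes that certificate with road (i):

* §1 `missingUpperBoundAt_two_mult_of_towerGap_of_eulerChar` — per member, control slot ABSTRACT (`hEC`, audit
  N-1): Kato `⊗ℚ` (`hKato`, MEMO RC-2) + Greenberg–Stevens at a split `2` (`hGS`, MEMO RC-4, guarded) + A236
  (`h41sp`) + modularity + GZK + `0 ≤ ord₂ ϖ` + `O1.TowerGapAtTwo W` ⟹ `MissingUpperBoundAt W 2`.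
* §2 `missingUpperBoundAt_two_mult_of_towerGapMember'` — the CLASS theorem on the GUARDED print
  (`…_anyPrime_oddLocalDegree` via `O1.twoAdicEulerCharRankZeroNonsplitMult_zero_of_greenberg'`): one member
  `W₁ ~ W` with a tower-gap certificate and a period datum (`Irr W₁ 2` — automatic on 617 of the 759 residual
  classes — or a lattice-optimal parametrisation datum, or `0 ≤ ord₂ ϖ` displayed) ⟹ `MissingUpperBoundAt W 2`
  (Cassels transport `missingUpperBoundAt_two_of_isogenous_member`).
* §3 `missingUpperBoundAt_two_mult_of_layerSelmer_of_localKernelBounds'` — §2 with the tower-gap certificate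
  DISCHARGED from finite layers exactly as in the good-ordinary TOWER door (tower-1): at an `E[2]`-irreducible
  member `W₁` (so `E₁(ℚ)[2] = 0`, `not_hasIrreducibleModPGaloisRep_of_dvd_torsionOrder`), layers `j ≤ j'`, a LOWER
  count `2^a ≤ #Sel_{2^∞}(E₁/ℚ_j)[2]`, an UPPER count `#Sel_{2^∞}(E₁/ℚ_{j'})[2] ≤ 2^d`, level-`j'` local kernel
  hypotheses {`𝒦_{v,j'}[2^∞] = 0` off `S`, `#𝒦_{v,j'}[2] ≤ C_v` on `S`, covers of size `N_v`} and the arithmetic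
  `2^d · ∏_{v∈S} C_v^{N_v} < 2^{2^{j'} − 2^j + a}`. On the residual `a = 2` at `j = 0` for every class
  (`ellrank = [0,2,0]` on 1 969/1 969 rank-`0` representatives, HOME mult/step0/KATO2/census6-all.tsv: `Sel₂(E/ℚ) ≅
  (ℤ/2)²` and `E(ℚ)[2] = 0` on the 1 673 irreducible ones), so the margin is `d + Σ_S N_v·log₂ C_v ≤ 2^{j'}`.

WHAT IS DISPLAYED, NOT PROVED (numbers, not adjectives). MEMO: `hKato` (PROOF-MULT, RC-2 PASS), `hGS` (PROOF-GS2,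
RC-4 PASS). PRINT: guarded Thm-4.1 analogue, A236, modularity, GZK, Cassels, Česnavičius. CERTIFICATES per class:
the two layer counts (tower engines A/B of seat bsd-2adic-tower-eng, built for the 528 good-ordinary classes; NOT
yet run on any multiplicative class — 0/759 today) and the level-`j'` local kernel bounds: off `2N` and at odd bad
primes these are Greenberg LNM 1716 Lemma 3.3 (tree facts of `Greenberg1999/ControlLocalKernelsLayer.lean`,
p428065); AT THE MULTIPLICATIVE PRIME `2` ALONG `ℚ_n` the bound `C_2` is NOT Lemma 3.4 (good ordinary) — it is
the multiplicative case of Greenberg's §3–§4 local analysis (non-split: `D_v(ℚ_{∞,η}) = (ℚ₂/ℤ₂)(φ)^{G} = ℤ/2`;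
split: the trivial-zero line), NOT typed in the tree: a WANTED Literature fact, displayed here as the
hypothesis `hC 2`. ∀-LEVEL CONTENT: none beyond road (i) — a tower-certified curve is ON the `μ = 0` road, i.e.
outside hypothesis (i) of the residual leaf `MultUpperHalvesAtTwo.UpperHalfOffFourRoadsAtMultTwo`
(`not_offMuRoad_of_towerGapAtTwo`). What it buys: a certificate-decidable form of the upper half on EVERY
residual class with an irreducible member (617/759), and at the optimal curve of the 142 «neither» classes once a
`2`-torsion-tolerant layer bridge exists (T10 itself has no torsion hypothesis; tower-1's bridge has).

References: R. Greenberg, LNM 1716 (1999), §3 pp. 85–90 (Lemmas 3.3–3.5), §4 pp. 112–113, Prop. 4.14; K. Kato,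
Astérisque 295 (2004), Thm. 17.4, 17.13; L. Washington, *Introduction to Cyclotomic Fields*, §13.2;
B. Mazur, J. Tate, J. Teitelbaum, Invent. Math. 84 (1986), §I.10, §I.14; K. Česnavičius, Thm. 1.2 (2018);
J. W. S. Cassels, Arithmetic VIII (1965); R. L. Miller, LMS J. Comput. Math. 14 (2011), Def. 1.1;
B. Mazur, IHÉS 47 (1977), III §5 (rational torsion ⟹ reducible).
-/

set_option autoImplicit false
set_option linter.dupNamespace false

noncomputable section

open scoped Classical MatrixGroups ModularForm

open NumberField IsDedekindDomain CongruenceSubgroup WeierstrassCurve Literature.NumberTheory.EllipticCurves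
  Literature.NumberTheory.EllipticCurves.ModularForms
  Literature.NumberTheory.EllipticCurves.Greenberg1999
  Literature.NumberTheory.EllipticCurves.Rank1Residual
  Literature.NumberTheory.EllipticCurves.Rank1Residual.Typed
  Summit.BirchSwinnertonDyer.Rank1Residual.X5

namespace Summit.BirchSwinnertonDyer.BirchSwinnertonDyer.Theorems

/-! ## §0 Bookkeeping: a tower-gap certificate puts the curve ON the `μ = 0` road -/

/-- **A tower-certified curve is on road (i).** `O1.TowerGapAtTwo W` gives `μ(X) = 0` for every cyclotomic
datum (T10, `O1.isTorsion_and_mu_eq_zero_of_towerGapAtTwo`) — i.e. the NEGATION of hypothesis (i) «off the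
`μ = 0` road» of the residual leaves `MultUpperHalvesAtTwo.UpperHalfOff{Road,Roads,FourRoads}AtMultTwo`. So the
tower road adds no ∀-level binder to the line `four_roads`: it is a way of DISCHARGING road (i) per class.
[cite: Washington1997, §13.2] -/
theorem mu_eq_zero_of_towerGapAtTwo (W : WeierstrassCurve ℚ) [W.IsElliptic] [W.IsGloballyMinimal]
    (hgap : O1.TowerGapAtTwo W) :
    ∀ (κ : ZpExtension ℚ 2) (γ : Field.absoluteGaloisGroup ℚ), κ.IsCyclotomic → κ.IsTopGenerator γ →
      IsCyclotomicVariable 2 γ → ∀ D : W.SelmerDualData κ γ, D.mu = 0 :=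
  fun _ _ hκ hγ hγ' D ↦ (O1.isTorsion_and_mu_eq_zero_of_towerGapAtTwo W hgap hκ hγ hγ' D).2

/-- The same, phrased as the failure of the residual's hypothesis (i). [cite: Washington1997, §13.2] -/
theorem not_offMuRoad_of_towerGapAtTwo (W : WeierstrassCurve ℚ) [W.IsElliptic] [W.IsGloballyMinimal]
    (hgap : O1.TowerGapAtTwo W) :
    ¬ ¬ ∀ (κ : ZpExtension ℚ 2) (γ : Field.absoluteGaloisGroup ℚ), κ.IsCyclotomic → κ.IsTopGenerator γ →
      IsCyclotomicVariable 2 γ → ∀ D : W.SelmerDualData κ γ, D.mu = 0 :=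
  fun h ↦ h (mu_eq_zero_of_towerGapAtTwo W hgap)

/-! ## §1 Per member, control slot abstract: the upper half from a tower-gap certificate -/

/-- **ROAD (vi) per member, `hEC`-abstract — the upper half from a TOWER-GAP certificate.** For a globally
minimal elliptic `W/ℚ` of analytic rank `0`, multiplicative at `2`: Kato's divisibility `⊗ℚ` at `2` (`hKato`,
MEMO PROOF-MULT RC-2), the non-split control display `hEC : O1.TwoAdicEulerCharRankZeroNonsplitMult W 0` (any
source; the split side uses A236 `h41sp`), modularity, GZK, Greenberg–Stevens at a split `2` (`hGS`, MEMO
PROOF-GS2 RC-4, guarded by the reduction type), the period datum `0 ≤ ord₂ ϖ` (`hper₀`) and the tower-gap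
certificate `O1.TowerGapAtTwo W` (ONE gap between two layer quotients of `X(E/ℚ_∞)`, for every cyclotomic datum)
⟹ `MissingUpperBoundAt W 2`. The certificate supplies `μ = 0` (T10); the rest is road (i)
(`missingUpperBoundAt_two_mult_of_mu_eq_zero_of_eulerChar`, p430028). No image hypothesis, no sign of `Δ`, no
rational `2`-torsion geometry. [cite: Washington1997, §13.2] [cite: Kato2004Asterisque, Thm. 17.4 (p. 273) and 17.13]
[cite: GreenbergLNM1716, §4 pp. 112–113] [cite: Miller2011LMS, Def. 1.1] -/
theorem missingUpperBoundAt_two_mult_of_towerGap_of_eulerChar (W : WeierstrassCurve ℚ) [W.IsElliptic]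
    [W.IsGloballyMinimal] (hKato : O1.KatoMultiplicativeDivisibilityRat W 2)
    (hEC : O1.TwoAdicEulerCharRankZeroNonsplitMult W 0)
    (h41sp : thm41Analogue_charValue_rankZero_split_baseChange_anyPrime)
    (hmod : nonempty_modularParametrizationData)
    (hGZK : rank_eq_analyticRank_of_analyticRank_le_one)
    (hGS : W.HasSplitMultiplicativeReductionAtPrime 2 → greenberg_stevens (W := W) (p := 2))
    (hper₀ : ∀ [NeZero (W.conductorNorm ℤ)] (f : CuspForm (Gamma0 (W.conductorNorm ℤ)) 2),
      IsNewformOf W f → ∀ ϖ : ℚ, (ϖ : ℝ) * W.realPeriodRat = plusPeriod f → 0 ≤ padicValRat 2 ϖ)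
    (hgap : O1.TowerGapAtTwo W) (hr : W.analyticRank = 0) (hmult : Mult W 2) :
    MissingUpperBoundAt W 2 :=
  missingUpperBoundAt_two_mult_of_mu_eq_zero_of_eulerChar W hKato hEC h41sp hmod hGZK hGS
    (mu_eq_zero_of_towerGapAtTwo W hgap) hper₀ hr hmult

/-! ## §2 The class theorem on the guarded print -/

/-- **ROAD (vi) for the class (GUARDED print).** For `W` of analytic rank `0` multiplicative at `2` and an
isogenous globally minimal member `W₁ ~_ℚ W` carrying (a) a TOWER-GAP certificate `O1.TowerGapAtTwo W₁` and (b)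
a period datum — `Irr W₁ 2` (then `ord₂ ϖ = 0` is PRINT: Česnavičius + odd isogenies,
`padicValRat_periodRatio_eq_zero_of_irr_two`), or a lattice-optimal parametrisation datum at level `N_{W₁}`
(`padicValRat_periodRatio_eq_zero_of_isOptimalDatum`), or `0 ≤ ord₂ ϖ` displayed — the upper half
`MissingUpperBoundAt W 2` holds at EVERY member, from PRINT {guarded Thm-4.1 analogue `h41ns'`, A236 `h41sp`,
modularity, GZK, Cassels, Česnavičius `hC`} + MEMO {Kato `⊗ℚ` at a multiplicative `2` for every non-CM curve
(`hKato`, RC-2), Greenberg–Stevens at a split `2` (`hGS`, RC-4)}. §1 at `W₁` (class data moved by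
`analyticRank_eq_of_isIsogenous'` and `hasMultiplicativeReductionAtPrime_of_isIsogenous`), then Cassels
(`missingUpperBoundAt_two_of_isogenous_member`). [cite: GreenbergLNM1716, §3 Note (p. 93) and §4 pp. 112–113]
[cite: Cesnavicius2018, Thm. 1.2] [cite: Cassels1965ArithmeticVIII] [cite: Washington1997, §13.2] [cite: Miller2011LMS, Def. 1.1] -/
theorem missingUpperBoundAt_two_mult_of_towerGapMember'
    (hKato : ∀ (W : WeierstrassCurve ℚ) [W.IsElliptic] [W.IsGloballyMinimal],
      ¬ W.HasCM → Mult W 2 → O1.KatoMultiplicativeDivisibilityRat W 2)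
    (h41ns' : thm41Analogue_charValue_rankZero_numberField_anyPrime_oddLocalDegree)
    (h41sp : thm41Analogue_charValue_rankZero_split_baseChange_anyPrime)
    (hmod : nonempty_modularParametrizationData)
    (hGZK : rank_eq_analyticRank_of_analyticRank_le_one)
    (hCassels : bsdRHS_eq_of_isIsogenous)
    (hC : cesnavicius_not_two_dvd_maninConstant_of_two_dvd_level)
    (hGS : ∀ (W : WeierstrassCurve ℚ) [W.IsElliptic] [W.IsGloballyMinimal],
      W.HasSplitMultiplicativeReductionAtPrime 2 → greenberg_stevens (W := W) (p := 2))
    (W : WeierstrassCurve ℚ) [W.IsElliptic] [W.IsGloballyMinimal]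
    (hr : W.analyticRank = 0) (hmult : Mult W 2)
    (W₁ : WeierstrassCurve ℚ) [W₁.IsElliptic] [W₁.IsGloballyMinimal] (hiso : IsIsogenous W W₁)
    (hgap : O1.TowerGapAtTwo W₁)
    (hB : Irr W₁ 2 ∨
      (∀ [NeZero (W₁.conductorNorm ℤ)],
        ∃ D : ModularParametrizationData W₁ (W₁.conductorNorm ℤ), Zhai2021.IsOptimalDatum W₁ D) ∨
      (∀ [NeZero (W₁.conductorNorm ℤ)] (f : CuspForm (Gamma0 (W₁.conductorNorm ℤ)) 2),
        IsNewformOf W₁ f → ∀ ϖ : ℚ, (ϖ : ℝ) * W₁.realPeriodRat = plusPeriod f →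
          0 ≤ padicValRat 2 ϖ)) :
    MissingUpperBoundAt W 2 := by
  -- the class data at `W₁`
  have hmult₁ : Mult W₁ 2 :=
    Summit.BirchSwinnertonDyer.Rank1Residual.X2.IsogenyQuotientLine.hasMultiplicativeReductionAtPrime_of_isIsogenous
      hiso hmult
  have hr₁ : W₁.analyticRank = 0 := (analyticRank_eq_of_isIsogenous' hiso).symm.trans hr
  have hcm₁ : ¬ W₁.HasCM := fun h ↦ Rank1Residual.not_mult_of_hasCM W₁ h 2 hmult₁
  -- the period datum at `W₁`
  have hper₁ : ∀ [NeZero (W₁.conductorNorm ℤ)] (f : CuspForm (Gamma0 (W₁.conductorNorm ℤ)) 2),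
      IsNewformOf W₁ f → ∀ ϖ : ℚ, (ϖ : ℝ) * W₁.realPeriodRat = plusPeriod f →
        0 ≤ padicValRat 2 ϖ := by
    rcases hB with hirr | hopt | hper
    · intro _ f hf ϖ hϖ
      exact (padicValRat_periodRatio_eq_zero_of_irr_two hC W₁ hmult₁ hirr f hf ϖ hϖ).ge
    · intro _ f hf ϖ hϖ
      obtain ⟨D, hD⟩ := hopt
      exact (padicValRat_periodRatio_eq_zero_of_isOptimalDatum hC W₁ hmult₁ D hD f hf ϖ hϖ).ge
    · exact hper
  -- §1 at `W₁` on the guarded control display, then Cassels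
  have hU₁ : MissingUpperBoundAt W₁ 2 :=
    missingUpperBoundAt_two_mult_of_towerGap_of_eulerChar W₁ (hKato W₁ hcm₁ hmult₁)
      (O1.twoAdicEulerCharRankZeroNonsplitMult_zero_of_greenberg' W₁ h41ns') h41sp hmod hGZK (hGS W₁)
      hper₁ hgap hr₁ hmult₁
  exact missingUpperBoundAt_two_of_isogenous_member hmod hGZK hCassels W hr W₁ hiso hU₁

/-! ## §3 The class theorem with the certificate read off two finite layers (tower-1's local form) -/

/-- `Irr W 2` ⟹ the torsion order is odd (a rational point of order `2` spans a `G_ℚ`-stable line).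
[cite: Mazur1977, Ch. III §5, p. 157] -/
theorem not_two_dvd_torsionOrder_of_irr_two (W : WeierstrassCurve ℚ) [W.IsElliptic] [W.IsGloballyMinimal]
    (hirr : Irr W 2) : ¬ 2 ∣ W.torsionOrder :=
  fun h ↦ not_hasIrreducibleModPGaloisRep_of_dvd_torsionOrder W 2 h hirr

/-- **ROAD (vi) for the class, CERTIFICATE FORM (what a per-class instance file supplies).** As
`missingUpperBoundAt_two_mult_of_towerGapMember'`, at an `E[2]`-IRREDUCIBLE member `W₁ ~_ℚ W` (period datum PRINT,
torsion order odd), with the tower-gap certificate DISCHARGED from two finite layers by tower-1's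
`KatoHalfPinch.towerGapAtTwo_of_localKernelBounds` (p428126): layers `j ≤ j'`; for every cyclotomic `κ` a LOWER
count `2^a ≤ #Sel_{2^∞}(E₁/ℚ_j)[2]` (`hlow`) and an UPPER count `#Sel_{2^∞}(E₁/ℚ_{j'})[2] ≤ 2^d` (`hup`); at
level `j'` the LOCAL KERNEL hypotheses — `𝒦_{v,j'}[2^∞] = 0` off a finite set `S` (`h0`), `#𝒦_{v,j'}[2] ≤ C_v`
on `S` (`hC'`), covers of the places above `v` of size `≤ N_v` (`hN`; `N_2 = 1`, `N_v ≤ 2^{j'}`) — and the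
arithmetic `2^d · ∏_{v∈S} C_v^{N_v} < 2^{2^{j'} − 2^j + a}` (`harith`). On the line's residual `a = 2` at `j = 0`.
The local hypotheses off `2` are Greenberg's Lemma 3.3 (tree facts, p428065); AT `v = 2` (multiplicative) the
bound `C_2` is the multiplicative case of LNM 1716 §3–§4, NOT typed in the tree (displayed). Inputs otherwise as
in §2: PRINT ×6 + MEMO {`hKato` RC-2, `hGS` RC-4}. [cite: GreenbergLNM1716, §3 pp. 85–90 (Lemmas 3.3–3.5) and §4 pp. 112–113]
[cite: Washington1997, §13.2] [cite: Cesnavicius2018, Thm. 1.2] [cite: Cassels1965ArithmeticVIII] [cite: Miller2011LMS, Def. 1.1] -/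
theorem missingUpperBoundAt_two_mult_of_layerSelmer_of_localKernelBounds'
    (hKato : ∀ (W : WeierstrassCurve ℚ) [W.IsElliptic] [W.IsGloballyMinimal],
      ¬ W.HasCM → Mult W 2 → O1.KatoMultiplicativeDivisibilityRat W 2)
    (h41ns' : thm41Analogue_charValue_rankZero_numberField_anyPrime_oddLocalDegree)
    (h41sp : thm41Analogue_charValue_rankZero_split_baseChange_anyPrime)
    (hmod : nonempty_modularParametrizationData)
    (hGZK : rank_eq_analyticRank_of_analyticRank_le_one)
    (hCassels : bsdRHS_eq_of_isIsogenous)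
    (hC : cesnavicius_not_two_dvd_maninConstant_of_two_dvd_level)
    (hGS : ∀ (W : WeierstrassCurve ℚ) [W.IsElliptic] [W.IsGloballyMinimal],
      W.HasSplitMultiplicativeReductionAtPrime 2 → greenberg_stevens (W := W) (p := 2))
    (W : WeierstrassCurve ℚ) [W.IsElliptic] [W.IsGloballyMinimal]
    (hr : W.analyticRank = 0) (hmult : Mult W 2)
    (W₁ : WeierstrassCurve ℚ) [W₁.IsElliptic] [W₁.IsGloballyMinimal] (hiso : IsIsogenous W W₁)
    (hirr : Irr W₁ 2) {j j' a d : ℕ} (hjj' : j ≤ j')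
    (S : Finset (HeightOneSpectrum (𝓞 ℚ))) (C N : HeightOneSpectrum (𝓞 ℚ) → ℕ)
    (hlow : ∀ κ : ZpExtension ℚ 2, κ.IsCyclotomic →
      2 ^ a ≤ Nat.card {z : W₁.selmerLayer κ j // 2 • z = 0})
    (hup : ∀ κ : ZpExtension ℚ 2, κ.IsCyclotomic →
      Nat.card {z : W₁.selmerLayer κ j' // 2 • z = 0} ≤ 2 ^ d)
    (h0 : ∀ κ : ZpExtension ℚ 2, κ.IsCyclotomic →
      ∀ v ∉ S, W₁.localTowerKerPrimary κ (v.adicCompletion ℚ) j' = ⊥)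
    (hC' : ∀ κ : ZpExtension ℚ 2, κ.IsCyclotomic → ∀ v ∈ S,
      Finite {x : W₁.localTowerKerPrimary κ (v.adicCompletion ℚ) j' // 2 • x = 0} ∧
        Nat.card {x : W₁.localTowerKerPrimary κ (v.adicCompletion ℚ) j' // 2 • x = 0} ≤ C v)
    (hN : ∀ κ : ZpExtension ℚ 2, κ.IsCyclotomic → ∀ v ∈ S,
      ∃ R : Finset (Field.absoluteGaloisGroup ℚ), R.card ≤ N v ∧
        ∀ σ : Field.absoluteGaloisGroup ℚ, ∃ ρ ∈ R,
          ∃ δ : Field.absoluteGaloisGroup (v.adicCompletion ℚ), ∃ τ ∈ κ.layerSubgroup j',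
            σ = resGal (K := ℚ) (v.adicCompletion ℚ) δ * ρ * τ)
    (harith : 2 ^ d * ∏ v ∈ S, C v ^ N v < 2 ^ (2 ^ j' - 2 ^ j + a)) :
    MissingUpperBoundAt W 2 :=
  missingUpperBoundAt_two_mult_of_towerGapMember' hKato h41ns' h41sp hmod hGZK hCassels hC hGS W hr hmult W₁
    hiso
    (KatoHalfPinch.towerGapAtTwo_of_localKernelBounds W₁ (not_two_dvd_torsionOrder_of_irr_two W₁ hirr) hjj' S
      C N hlow hup h0 hC' hN harith)
    (Or.inl hirr)

/-- **ROAD (vi) for the class, KERNEL FORM** (tower-1's `towerGapAtTwo_of_layerClasses`, p428126/p428599): the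
upper datum is a bound `#A_{j'}[2] ≤ 2^b` on the `2`-torsion of `A_{j'} = h_{j'}⁻¹(Sel_∞) ⊆ H¹(ℚ_{j'}, E₁[2^∞])`
(EXACTLY `#X/(2,T^{2^{j'}})X`, no local error term), with `b < 2^{j'} − 2^j + a`. Everything else as in the
certificate form. [cite: GreenbergLNM1716, §1 p. 60 and §3 pp. 85–90] [cite: Washington1997, §13.2] [cite: Miller2011LMS, Def. 1.1] -/
theorem missingUpperBoundAt_two_mult_of_layerClasses'
    (hKato : ∀ (W : WeierstrassCurve ℚ) [W.IsElliptic] [W.IsGloballyMinimal],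
      ¬ W.HasCM → Mult W 2 → O1.KatoMultiplicativeDivisibilityRat W 2)
    (h41ns' : thm41Analogue_charValue_rankZero_numberField_anyPrime_oddLocalDegree)
    (h41sp : thm41Analogue_charValue_rankZero_split_baseChange_anyPrime)
    (hmod : nonempty_modularParametrizationData)
    (hGZK : rank_eq_analyticRank_of_analyticRank_le_one)
    (hCassels : bsdRHS_eq_of_isIsogenous)
    (hC : cesnavicius_not_two_dvd_maninConstant_of_two_dvd_level)
    (hGS : ∀ (W : WeierstrassCurve ℚ) [W.IsElliptic] [W.IsGloballyMinimal],
      W.HasSplitMultiplicativeReductionAtPrime 2 → greenberg_stevens (W := W) (p := 2))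
    (W : WeierstrassCurve ℚ) [W.IsElliptic] [W.IsGloballyMinimal]
    (hr : W.analyticRank = 0) (hmult : Mult W 2)
    (W₁ : WeierstrassCurve ℚ) [W₁.IsElliptic] [W₁.IsGloballyMinimal] (hiso : IsIsogenous W W₁)
    (hirr : Irr W₁ 2) {j j' a b : ℕ} (hjj' : j ≤ j')
    (hlow : ∀ κ : ZpExtension ℚ 2, κ.IsCyclotomic →
      2 ^ a ≤ Nat.card {z : W₁.selmerLayer κ j // 2 • z = 0})
    (hup : ∀ κ : ZpExtension ℚ 2, κ.IsCyclotomic →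
      Nat.card {z : W₁.selmerInftyPreimage κ j' // 2 • z = 0} ≤ 2 ^ b)
    (hab : b < 2 ^ j' - 2 ^ j + a) : MissingUpperBoundAt W 2 :=
  missingUpperBoundAt_two_mult_of_towerGapMember' hKato h41ns' h41sp hmod hGZK hCassels hC hGS W hr hmult W₁
    hiso
    (KatoHalfPinch.towerGapAtTwo_of_layerClasses W₁ (not_two_dvd_torsionOrder_of_irr_two W₁ hirr) hjj' hlow
      hup hab)
    (Or.inl hirr)

end Summit.BirchSwinnertonDyer.BirchSwinnertonDyer.Theorems

end
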